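import Summits.Schanuel.Schanuel.Theorems.RootDecomp1KCollarCell03

/-!
# RootDecomp1KCollarCell — lens 1, generation 48, node 7 «THE COLLAR CELL: skeleton-RESONANT dyadic approximants are never level points (2-adic interlacing, all P, m-free), with a certified member of EXACT Skel-order m» (CLAIM L2417, EX-ANTE PRICE + CHECKLIST K-g48 L2418, NODE L2431 / REQUEST L2432; critic VERDICT L2435: CLEARED AS PRICED — ONE CELL ×1 «DYADIC COLLAR», RULE K-R37, PORT GO) — continuation (RootDecomp1KCollarCell04): §3b the member ρ♮_m: numerators, truncations t_k, overshoots u_k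

(lens-1 g48 HOME kernel K = HOME/decomp-schanuel-lens-1/g48/CollarCell.lean f82e9183…, 1281 l, imports …RootDecomp1KDegreeLadder05 + …RootDecomp1KDarkLogSq04 BY NAME; P CollarCellProbe.lean 50792f78… rc 0 / C CollarCellCtrl.lean 9aabc182… rc 1 = 14 planted; memo NODE-g48.md; NODE L2431 / REQUEST L2432. Port by census-1 gen 21 as `RootDecomp1KCollarCell01–06` along K's §1–§5 with §3 cut in two by the 400-line file cap: 01 = §1 (T1) the 2-adic interlacing lemma `twoAdic_bev_ne_zero` with `maxval₂`, `weights_injective`; 02 = §2 the class `DyadicCollarLiouville` («[class] definition» tag) and its engine `bev_ne_zero_of_collar` (T2), `algebraicIndependent_ell2_of_collar` (T3), `statement_b_on_collar_ge_one`, `not_dyadicCollarLiouville_uStar`, `sb_collarPair` / `coordLiouvilleSchanuel_collarPair` (T4, item 31077's binders verbatim at n = 2, whole class, hyp-free); 03 = §3a the run pattern `Nn`/`fN`/`gN`, increments `aN`, `rhoNat`, tails `tailN`; 04 = §3b numerators `MN`, truncations `tN`, overshoots `uN`/`UN`, `iota_two_pow_fN`, `rhoNat_ne_tN`; 05 = §4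 certificates M1 `dyadicCollarLiouville_rhoNat`, M2 `skelLiouvilleFix_rhoNat`, cover `rhoNat_cover`, M3 `not_skelLiouvilleFix_succ_rhoNat` / `not_skelLiouville_rhoNat`, M4 `not_factorialGapLiouville_rhoNat`, M5 `not_logLogLiouville_rhoNat` + `not_logSqLiouville_rhoNat` / `not_logHyperLiouville_rhoNat` / `not_hyperLiouville_rhoNat` / `not_liouvilleOrder_rhoNat`, `liouville_rhoNat`, `dyadicCollarLiouville_not_subset`; 06 = §5 the exhibited tuple `zN2 = (ℓ₂, ρ♮₂)`: `linearIndependent_zN2`, `coordLiouvilleSpan_zN2`, `zN2_in_scope_31077`, `sb_zN2`, `coordLiouvilleSchanuel_at_zN2`, `item31077_at_zN2`, `rhoNat_two_profile` — ALL HYP-FREE. PORT EDITS (census convention, as sanctioned for every K-line port): `set_option linter.dupNamespace false` dropped; «[class] definition (membership predicate with parameters, NOT a fact; census convention)» wording on `DyadicCollarLiouville`; 35 one-line helper docstrings added; K's `liouvilleNumber_two_lt` (§2) DELETED in favour of the byte-identical tree decl `RootDecomp1KRelLiouvilleCell.liouvilleNumber_two_lt` (RelLiouvilleCell03, already in the import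 cone; dedup bounce p838600) — referenced via the §2 `open … (… liouvilleNumber_two_lt)` list; two generic §1 one-liners privatised; per-part private helper copies if any; statements and proofs otherwise verbatim (no renames). `--supports stmt-Schanuel-31077`; no census credit carried; rung 0 — nothing here proves Schanuel; no ∀-item moves; 31077 and 33364 stay OPEN.)
-/

noncomputable section

open Polynomial LiouvilleNumber
open scoped Nat

namespace Summit.Schanuel.Schanuel.Theorems.RootDecomp1KCollarCell

open Summit.Schanuel.Schanuel.Theorems.RootDecomp1KDegreeLadder
  (bev bev_eq_double_sum xdeg natDegree_coeff_le_xdeg specX aeval_specX natDegree_specX_le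
   abs_aeval_ge_of_ne_zero lipschitz_x lipschitz_y algebraicIndependent_of_no_relation)
open Summit.Schanuel.Schanuel.Theorems.RootDecomp1KSkelCell
  (iota iota_spec iota_le_of_le pow_lt_of_lt_iota lt_iota_of_pow_lt iota_mono one_le_iota
   SkelLiouville SkelLiouvilleFix skelLiouville_iff_fix SkelLiouvilleFix.mono logLogLiouville_skelLiouville)
open Summit.Schanuel.Schanuel.Theorems.RootDecomp1KLogLogCell
  (LogLogLiouville logLogLiouville_of_logSqLiouville logLogLiouville_of_logHyperLiouville
   logLogLiouville_of_hyperLiouville)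
open Summit.Schanuel.Schanuel.Theorems.RootDecomp1KGeneric (LogSqLiouville LiouvilleOrder)
open Summit.Schanuel.Schanuel.Theorems.RootDecomp1KRelLiouvilleCell (LogHyperLiouville)
open Summit.Schanuel.Schanuel.Theorems.RootDecomp1KDarkLogSq (logHyperLiouville_of_liouvilleOrder)
open Summit.Schanuel.Schanuel.Theorems.RootDecomp1KTwoBaseCell
  (psNumer partialSum_eq_psNumer_div coprime_psNumer sb_of_range_eq')
open Summit.Schanuel.Schanuel.Theorems.RootDecomp1KGapCell (FactorialGapLiouville)
open Summit.Schanuel.Schanuel.Theorems.RootDecomp1KHyper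
open Summit.Schanuel.Schanuel.Theorems.RootDecomp1KHyper.HyperCell

/-- numerators of the truncations: `M_0 := 1`, `M_{k+1} := M_k·2^{f_{k+1}−f_k} + 2·2^{f_{k+1}−g_k} − 1` (odd). -/
def MN (m : ℕ) : ℕ → ℤ
  | 0 => 1
  | k + 1 => MN m k * 2 ^ (fN m (k + 1) - fN m k) + 2 * 2 ^ (fN m (k + 1) - gN m k) - 1

/-- Every numerator `M_k` is odd. -/
theorem MN_odd (m : ℕ) : ∀ k, Odd (MN m k)
  | 0 => by simp [MN]
  | k + 1 => by
    simp only [MN]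
    have h1 : 1 ≤ fN m (k + 1) - fN m k := by have := fN_lt_fN_succ m k; omega
    have h2 : 1 ≤ fN m (k + 1) - gN m k := by have := gN_add_two_le_fN_succ m k; omega
    have e1 : Even (MN m k * 2 ^ (fN m (k + 1) - fN m k)) := by
      refine Even.mul_left ?_ _
      exact (Int.even_pow' (by omega)).mpr even_two
    have e2 : Even ((2 : ℤ) * 2 ^ (fN m (k + 1) - gN m k)) := Even.mul_right even_two _
    exact (e1.add e2).sub_odd odd_one

/-- Every numerator `M_k` is positive. -/
theorem MN_pos (m : ℕ) : ∀ k, 0 < MN m k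
  | 0 => by simp [MN]
  | k + 1 => by
    simp only [MN]
    have h := MN_pos m k
    have h1 : (1 : ℤ) ≤ 2 ^ (fN m (k + 1) - fN m k) := one_le_pow₀ (by norm_num)
    have h2 : (1 : ℤ) ≤ 2 ^ (fN m (k + 1) - gN m k) := one_le_pow₀ (by norm_num)
    nlinarith

/-- the TRUNCATION `t_k := M_k / 2^{f_k}` (the binary expansion of `ρ♮` cut after position `f_k`). -/
def tN (m k : ℕ) : ℚ := (MN m k : ℚ) / (2 : ℚ) ^ fN m k

/-- `(t_k : ℝ) = M_k / 2^{f_k}`. -/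
theorem tN_cast (m k : ℕ) : ((tN m k : ℚ) : ℝ) = (MN m k : ℝ) / (2 : ℝ) ^ fN m k := by
  unfold tN; push_cast; rfl

/-- EXACT denominator `den t_k = 2^{f_k}` (odd numerator). -/
theorem tN_den (m k : ℕ) : (tN m k).den = 2 ^ fN m k := by
  have hodd : Odd (MN m k).natAbs := Int.natAbs_odd.mpr (MN_odd m k)
  have hcop : Nat.Coprime (MN m k).natAbs (((2 : ℤ) ^ fN m k)).natAbs := by
    rw [Int.natAbs_pow]
    exact Nat.Coprime.pow_right _ (Nat.coprime_two_right.mpr hodd)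
  have h := Rat.den_div_eq_of_coprime (a := MN m k) (b := (2 : ℤ) ^ fN m k) (by positivity) hcop
  have e : (((MN m k : ℤ) : ℚ) / (((2 : ℤ) ^ fN m k : ℤ) : ℚ)) = tN m k := by unfold tN; push_cast; rfl
  rw [e] at h
  exact_mod_cast h

/-- `((t_k).den : ℝ) = 2^{f_k}`. -/
theorem tN_den_cast (m k : ℕ) : ((tN m k).den : ℝ) = (2 : ℝ) ^ fN m k := by
  rw [tN_den]; push_cast; rfl

/-- `t_0 = 1 / 2^{f_0}`. -/
theorem tN_zero (m : ℕ) : ((tN m 0 : ℚ) : ℝ) = 1 / (2 : ℝ) ^ fN m 0 := by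
  rw [tN_cast]; simp [MN]

/-- `t_{k+1} = t_k + a_k`. -/
theorem tN_succ (m k : ℕ) : ((tN m (k + 1) : ℚ) : ℝ) = tN m k + aN m k := by
  rw [tN_cast, tN_cast]
  unfold aN
  simp only [MN]
  have hf : fN m k ≤ fN m (k + 1) := (fN_lt_fN_succ m k).le
  have hg : gN m k ≤ fN m (k + 1) := by have := gN_add_two_le_fN_succ m k; omega
  have e1 : (2 : ℝ) ^ fN m (k + 1) = (2 : ℝ) ^ fN m k * (2 : ℝ) ^ (fN m (k + 1) - fN m k) := by
    rw [← pow_add, Nat.add_sub_cancel' hf]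
  have e2 : (2 : ℝ) ^ fN m (k + 1) = (2 : ℝ) ^ gN m k * (2 : ℝ) ^ (fN m (k + 1) - gN m k) := by
    rw [← pow_add, Nat.add_sub_cancel' hg]
  have h1 : (2 : ℝ) ^ (fN m (k + 1) - fN m k) / (2 : ℝ) ^ fN m (k + 1) = 1 / (2 : ℝ) ^ fN m k := by
    rw [e1]; field_simp
  have h2 : (2 : ℝ) ^ (fN m (k + 1) - gN m k) / (2 : ℝ) ^ fN m (k + 1) = 1 / (2 : ℝ) ^ gN m k := by
    rw [e2]; field_simp
  push_cast
  calc ((MN m k : ℝ) * (2 : ℝ) ^ (fN m (k + 1) - fN m k) + 2 * (2 : ℝ) ^ (fN m (k + 1) - gN m k) - 1) /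
        (2 : ℝ) ^ fN m (k + 1)
      = (MN m k : ℝ) * ((2 : ℝ) ^ (fN m (k + 1) - fN m k) / (2 : ℝ) ^ fN m (k + 1)) +
          2 * ((2 : ℝ) ^ (fN m (k + 1) - gN m k) / (2 : ℝ) ^ fN m (k + 1)) - 1 / (2 : ℝ) ^ fN m (k + 1) := by
        ring
    _ = (MN m k : ℝ) / (2 : ℝ) ^ fN m k + (2 / (2 : ℝ) ^ gN m k - 1 / (2 : ℝ) ^ fN m (k + 1)) := by
        rw [h1, h2]; ring

/-- `ρ♮ = t_k + T_k`. -/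
theorem rhoNat_eq_tN_add_tailN {m : ℕ} (hm : 1 ≤ m) : ∀ k, rhoNat m = tN m k + tailN m k
  | 0 => by rw [tN_zero]; unfold rhoNat tailN; simp
  | k + 1 => by rw [tN_succ, add_assoc, ← tailN_succ hm k]; exact rhoNat_eq_tN_add_tailN hm k

/-- `ρ♮_m − t_k = tail_k` (for `m ≥ 1`). -/
theorem rhoNat_sub_tN {m : ℕ} (hm : 1 ≤ m) (k : ℕ) : rhoNat m - tN m k = tailN m k := by
  rw [rhoNat_eq_tN_add_tailN hm k]; ring

/-- the OVERSHOOT `u_k := t_k + 2^{1−g_k}` (round the run of ones `[g_k, f_{k+1}]` up). -/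
def uN (m k : ℕ) : ℚ := tN m k + 2 / (2 : ℚ) ^ gN m k

/-- its numerator over `2^{g_k − 1}`: `M_k 2^{g_k − 1 − f_k} + 1` (odd). -/
def UN (m k : ℕ) : ℤ := MN m k * 2 ^ (gN m k - 1 - fN m k) + 1

/-- `u_k = U_k / 2^{g_k − 1}` (for `m ≥ 1`). -/
theorem uN_eq {m : ℕ} (hm : 1 ≤ m) (k : ℕ) : uN m k = (UN m k : ℚ) / (2 : ℚ) ^ (gN m k - 1) := by
  unfold uN UN tN
  have hfg : fN m k ≤ gN m k - 1 := by have := fN_add_three_le_gN hm k; omega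
  obtain ⟨g', hg'⟩ : ∃ g', gN m k = g' + 1 := ⟨gN m k - 1, by have := fN_add_three_le_gN hm k; omega⟩
  have hg1 : gN m k - 1 = g' := by omega
  rw [hg1] at hfg ⊢
  rw [hg']
  have e1 : (2 : ℚ) ^ g' = (2 : ℚ) ^ fN m k * (2 : ℚ) ^ (g' - fN m k) := by
    rw [← pow_add, Nat.add_sub_cancel' hfg]
  rw [pow_succ, e1]
  push_cast
  field_simp

/-- The overshoot numerator `U_k` is odd (for `m ≥ 1`). -/
theorem UN_odd {m : ℕ} (hm : 1 ≤ m) (k : ℕ) : Odd (UN m k) := by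
  unfold UN
  have h1 : 1 ≤ gN m k - 1 - fN m k := by have := fN_add_three_le_gN hm k; omega
  have e1 : Even (MN m k * 2 ^ (gN m k - 1 - fN m k)) := by
    refine Even.mul_left ?_ _
    exact (Int.even_pow' (by omega)).mpr even_two
  exact e1.add_odd odd_one

/-- EXACT denominator `den u_k = 2^{g_k − 1}`. -/
theorem uN_den {m : ℕ} (hm : 1 ≤ m) (k : ℕ) : (uN m k).den = 2 ^ (gN m k - 1) := by
  have hodd : Odd (UN m k).natAbs := Int.natAbs_odd.mpr (UN_odd hm k)
  have hcop : Nat.Coprime (UN m k).natAbs (((2 : ℤ) ^ (gN m k - 1))).natAbs := by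
    rw [Int.natAbs_pow]
    exact Nat.Coprime.pow_right _ (Nat.coprime_two_right.mpr hodd)
  have h := Rat.den_div_eq_of_coprime (a := UN m k) (b := (2 : ℤ) ^ (gN m k - 1)) (by positivity) hcop
  have e : (((UN m k : ℤ) : ℚ) / (((2 : ℤ) ^ (gN m k - 1) : ℤ) : ℚ)) = uN m k := by
    rw [uN_eq hm k]; push_cast; rfl
  rw [e] at h
  exact_mod_cast h

/-- `((u_k).den : ℝ) = 2^{g_k − 1}` (for `m ≥ 1`). -/
theorem uN_den_cast {m : ℕ} (hm : 1 ≤ m) (k : ℕ) : ((uN m k).den : ℝ) = (2 : ℝ) ^ (gN m k - 1) := by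
  rw [uN_den hm]; push_cast; rfl

/-- `(u_k : ℝ) = t_k + 2 / 2^{g_k}`. -/
theorem uN_cast (m k : ℕ) : ((uN m k : ℚ) : ℝ) = (tN m k : ℝ) + 2 / (2 : ℝ) ^ gN m k := by
  unfold uN; push_cast; rfl

/-- `u_k − ρ♮ = 2^{−f_{k+1}} − T_{k+1} ∈ (2^{−f_{k+1}−1}, 2^{−f_{k+1}})`. -/
theorem uN_sub_rhoNat {m : ℕ} (hm : 1 ≤ m) (k : ℕ) :
    (uN m k : ℝ) - rhoNat m = 1 / (2 : ℝ) ^ fN m (k + 1) - tailN m (k + 1) := by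
  rw [uN_cast, rhoNat_eq_tN_add_tailN hm k, tailN_succ hm k]
  unfold aN; ring

/-- `1 / (2 · 2^{f_{k+1}}) < u_k − ρ♮_m < 1 / 2^{f_{k+1}}` (for `m ≥ 1`). -/
theorem uN_sub_rhoNat_bounds {m : ℕ} (hm : 1 ≤ m) (k : ℕ) :
    1 / (2 * (2 : ℝ) ^ fN m (k + 1)) < (uN m k : ℝ) - rhoNat m ∧
      (uN m k : ℝ) - rhoNat m < 1 / (2 : ℝ) ^ fN m (k + 1) := by
  rw [uN_sub_rhoNat hm k]
  have h1 := tailN_lt_half_pow_fN hm (k + 1)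
  have h2 := tailN_pos hm (k + 1)
  have e : 1 / (2 : ℝ) ^ fN m (k + 1) = 2 * (1 / (2 * (2 : ℝ) ^ fN m (k + 1))) := by
    field_simp
  constructor
  · linarith
  · linarith

/-- `ι(2^{f_k}) = N_k + 1`. -/
theorem iota_two_pow_fN (m k : ℕ) : iota (2 ^ fN m k) = Nn m k + 1 := by
  apply le_antisymm
  · exact iota_le_of_le (Nat.pow_le_pow_right two_pos (fN_le_factorial_succ m k))
  · exact lt_iota_of_pow_lt (Nat.pow_lt_pow_right (by norm_num) (factorial_lt_fN m k))

/-- `ι(2^{g_k − 1}) ≥ N_k + 2` (`m ≥ 1`). -/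
theorem iota_two_pow_gN_pred {m : ℕ} (hm : 1 ≤ m) (k : ℕ) : Nn m k + 2 ≤ iota (2 ^ (gN m k - 1)) := by
  have h : (Nn m k + 1)! < gN m k - 1 := by
    unfold gN fN
    rw [Nat.factorial_succ, Nat.add_sub_cancel]
    have h1 : 1 ≤ Nn m k := by have := le_Nn m k; omega
    have h2 : (Nn m k + 1) * ((Nn m k)! + Nn m k) ≤ m * (Nn m k + 1) * ((Nn m k)! + Nn m k) := by
      rw [mul_assoc]; exact Nat.le_mul_of_pos_left _ hm
    have h3 : (Nn m k + 1) * (Nn m k)! < (Nn m k + 1) * ((Nn m k)! + Nn m k) :=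
      Nat.mul_lt_mul_of_pos_left (by omega) (by omega)
    exact lt_of_lt_of_le h3 h2
  exact lt_iota_of_pow_lt (Nat.pow_lt_pow_right (by norm_num) h)

/-- `ρ♮ ≠ t_k`. -/
theorem rhoNat_ne_tN {m : ℕ} (hm : 1 ≤ m) (k : ℕ) : rhoNat m ≠ tN m k := by
  intro h
  have := rhoNat_sub_tN hm k
  rw [h, sub_self] at this
  exact (tailN_pos hm k).ne this

end Summit.Schanuel.Schanuel.Theorems.RootDecomp1KCollarCell

end
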